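import Literature.Computability.AlgebraicComplexity.KoszulFlatteningGeneralDim
import HarnessLib

/-!
# Koszul–Young integer certificates for every `(dim A', p)`: subsets by bitmask, memoised table

Topic `Literature/Computability/AlgebraicComplexity`; a trunk-independent TOOL completing
`KoszulFlatteningGeneralDim.lean`: there the Koszul flattening
`T_{A'}^{∧p} : Λ^p K^q ⊗ (K^b)^* → Λ^{p+1} K^q ⊗ K^c` is defined for every `q = dim A'` and every `p`
(`koszulFlatteningGen q p`) together with the bound `rank ≤ C(q-1, p) · bR` (Landsberg–Ottaviani),
but an integer certificate layer exists only for `q = 4`, `p = 1` (`KYGen.kyEntry4`).  Here the code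
layer is written once for all `(q, p)`, for the full first factor (`Φ = id`, `dim A = q`): the
`p`-subsets of `Fin q` are numbered through the list of bitmasks of popcount `p` (`validMasks`,
decoded by `maskSet`; an invalid code decodes to a default subset supplied by the caller, so the code
matrix is a genuine repetition-submatrix of the flattening), the entries are computed from the
definition of `wedgeMatrix` (`kyEntry`, identified with `koszulFlatteningGen q p 1.mulVecLin T` by
`kyEntry_eq`), MEMOISED in the table `kyTable` (so that a kernel evaluation of a row certificate
evaluates each entry once), and a unit-pivot row certificate (`intTriCheckUnit`) of
`n > C(q-1, p) · (R - 1)` independent rows gives `R ≤ bR(T ⊗ K)` over every field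
(`le_algBorderRank_of_kyCheck`).  Transport lemmas for the two missing coordinate permutations
(`le_algBorderRank_of_swap₁₂`, `le_algBorderRank_of_swap₂₃'`) let a table certify the flattening with
ANY factor wedged and any other dualised.  HONEST FRAMING: the value is DECIDABLE VERDICTS /
CERTIFICATES about explicit small tensors, not progress on the exponent of matrix multiplication.
First client: the `bound` nodes of the torus-fixed-point refutation trees of the tight-`[4]^3` census
(flattenings with `(q, p) ∈ {(4,1), (4,2), (5,2), (5,3), (6,1), (6,2), (6,3)}` of extended tensors).

## References

* J. M. Landsberg, G. Ottaviani, *New lower bounds for the border rank of matrix multiplication*,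
  Theory of Computing 11 (2015) 285–298, Thm. 2.1. [LandsbergOttaviani2015]
* J. M. Landsberg, *Geometry and complexity theory*, CUP 2017, §2.4.2, Prop. 2.4.2.1.
  [LandsbergGCT2017]
* A. Conner, F. Gesmundo, J. M. Landsberg, E. Ventura, comput. complexity 31 (2022), §3 eq. (8).
  [ConnerGesmundoLandsbergVentura2022]
* M. Bläser, *Fast Matrix Multiplication*, Theory of Computing Graduate Surveys 5 (2013), §5.1,
  Def. 6.1. [Blaser2013]
-/

open scoped BigOperators Matrix
open Matrix

namespace Literature.Computability.AlgebraicComplexity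

namespace KYMask

open KYCert KYGen Literature.LinearAlgebra.Matrix

universe u

/-! ## Subsets of `Fin q` by bitmask -/

/-- Popcount with fuel (`fuel ≥` number of bits): `popcF fuel n = #{i < fuel | bit i of n}` for
`n < 2^fuel`.  Only used to pre-select codes; soundness does not depend on it. [folklore] -/
def popcF : ℕ → ℕ → ℕ
  | 0, _ => 0
  | fuel + 1, n => n % 2 + popcF fuel (n / 2)

/-- The bitmasks `< 2^q` of popcount `k`, in increasing order (the numbering of the `k`-subsets of
`Fin q` used by the codes). [folklore] -/
def validMasks (q k : ℕ) : List ℕ := (List.range (2 ^ q)).filter fun m => popcF q m == k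

/-- The subset of `Fin q` with characteristic vector the bits of `m`. [folklore] -/
def maskSet (q m : ℕ) : Finset (Fin q) := Finset.univ.filter fun i : Fin q => Nat.testBit m i.1

/-- Row decoder: code `ρ ↦ ((p+1)-subset no. ρ / c, third index ρ % c)`; a code whose subset has the
wrong size decodes to the default `dT`. [folklore] -/
def rowDec (q p c : ℕ) [NeZero c] (dT : PSub q (p + 1)) (ρ : ℕ) : PSub q (p + 1) × Fin c :=
  (if h : (maskSet q ((validMasks q (p + 1)).getD (ρ / c) 0)).card = p + 1
     then ⟨maskSet q ((validMasks q (p + 1)).getD (ρ / c) 0), h⟩ else dT, finCode c ρ)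

/-- Column decoder: code `σ ↦ (p-subset no. σ / b, second index σ % b)`; invalid codes decode to
`dS`. [folklore] -/
def colDec (q p b : ℕ) [NeZero b] (dS : PSub q p) (σ : ℕ) : PSub q p × Fin b :=
  (if h : (maskSet q ((validMasks q p).getD (σ / b) 0)).card = p
     then ⟨maskSet q ((validMasks q p).getD (σ / b) 0), h⟩ else dS, finCode b σ)

/-- Number of row codes `C(q, p+1) · c` (all `(p+1)`-masks times the third index). [folklore] -/
def nRows (q p c : ℕ) : ℕ := (validMasks q (p + 1)).length * c

/-- Number of column codes `C(q, p) · b`. [folklore] -/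
def nCols (q p b : ℕ) : ℕ := (validMasks q p).length * b

/-! ## The flattening on codes, its table, and the certificate -/

/-- Entry `(ρ, σ)` of the integer Koszul flattening `T_{A}^{∧p}` (`A = K^q` the full first factor)
on codes, straight from the definition of `wedgeMatrix`:
`∑_{x<q} [x ∉ S ∧ R = S ∪ {x}] ε(S, x) · T x (σ % b) (ρ % c)`.
[cite: LandsbergGCT2017, §2.4.2 (2.4.6)] [cite: LandsbergOttaviani2015, Thm. 2.1] -/
def kyEntry (q p b c : ℕ) [NeZero q] [NeZero b] [NeZero c] (dT : PSub q (p + 1)) (dS : PSub q p)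
    (T : Fin q → Fin b → Fin c → ℤ) (ρ σ : ℕ) : ℤ :=
  let R := rowDec q p c dT ρ
  let S := colDec q p b dS σ
  lsum q fun x =>
    (if finCode q x ∉ S.1.1 ∧ R.1.1 = insert (finCode q x) S.1.1
      then koszulSign S.1.1 (finCode q x) else 0) * T (finCode q x) S.2 R.2

/-- The memoised table of `kyEntry` over all codes `ρ < nRows`, `σ < nCols`. [folklore] -/
def kyTable (q p b c : ℕ) [NeZero q] [NeZero b] [NeZero c] (dT : PSub q (p + 1)) (dS : PSub q p)
    (T : Fin q → Fin b → Fin c → ℤ) : List (List ℤ) :=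
  (List.range (nRows q p c)).map fun ρ =>
    (List.range (nCols q p b)).map fun σ => kyEntry q p b c dT dS T ρ σ

/-- The code matrix read from the table (codes reduced modulo the code ranges). [folklore] -/
def kyCode (q p b c : ℕ) [NeZero q] [NeZero b] [NeZero c] (dT : PSub q (p + 1)) (dS : PSub q p)
    (T : Fin q → Fin b → Fin c → ℤ) (ρ σ : ℕ) : ℤ :=
  mget (kyTable q p b c dT dS T) (ρ % nRows q p c) (σ % nCols q p b)

/-- **The `(q, p)` Koszul–Young certificate check**: the code ranges are non-empty and `n` rows of
the code matrix are certified independent with unit pivots. [cite: LandsbergOttaviani2015, Thm. 2.1] -/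
def kyCheck (q p b c : ℕ) [NeZero q] [NeZero b] [NeZero c] (dT : PSub q (p + 1)) (dS : PSub q p)
    (T : Fin q → Fin b → Fin c → ℤ) (n : ℕ) (rows : List (List (ℕ × ℤ))) (piv : List ℕ) : Bool :=
  decide (0 < nRows q p c) && decide (0 < nCols q p b) &&
    intTriCheckUnit n (kyCode q p b c dT dS T) rows piv

/-! ## Soundness -/

/-- Reading the table inside the code ranges. [folklore] -/
theorem mget_table {R C : ℕ} (f : ℕ → ℕ → ℤ) {ρ σ : ℕ} (hρ : ρ < R) (hσ : σ < C) :
    mget ((List.range R).map fun ρ => (List.range C).map fun σ => f ρ σ) ρ σ = f ρ σ := by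
  unfold mget
  have h1 : ((List.range R).map fun ρ => (List.range C).map fun σ => f ρ σ).getD ρ [] =
      (List.range C).map fun σ => f ρ σ := by
    rw [List.getD_eq_getElem?_getD, List.getElem?_map, List.getElem?_range hρ]; rfl
  rw [h1, List.getD_eq_getElem?_getD, List.getElem?_map, List.getElem?_range hσ]; rfl

/-- The code entry IS the entry of `koszulFlatteningGen q p id` at the decoded indices (over `ℤ`).
[cite: LandsbergGCT2017, §2.4.2 (2.4.6)] -/
theorem kyEntry_eq (q p b c : ℕ) [NeZero q] [NeZero b] [NeZero c] (dT : PSub q (p + 1))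
    (dS : PSub q p) (T : Fin q → Fin b → Fin c → ℤ) (ρ σ : ℕ) :
    kyEntry q p b c dT dS T ρ σ =
      koszulFlatteningGen q p (1 : Matrix (Fin q) (Fin q) ℤ).mulVecLin T (rowDec q p c dT ρ)
        (colDec q p b dS σ) := by
  have hf : ∀ x : Fin q, finCode q (x : ℕ) = x := fun x => Fin.ext (Nat.mod_eq_of_lt x.isLt)
  rw [koszulFlatteningGen_apply, wedgeMatrix_apply]
  simp only [kyEntry, lsum_eq, hf, Matrix.mulVecLin_apply, Matrix.one_mulVec, Int.cast_id]
  refine Finset.sum_congr rfl fun x _ => ?_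
  split_ifs <;> simp

/-- The code matrix is a repetition-submatrix of the flattening. [cite: LandsbergGCT2017, §2.4.2 (2.4.6)] -/
theorem kyCode_eq (q p b c : ℕ) [NeZero q] [NeZero b] [NeZero c] (dT : PSub q (p + 1))
    (dS : PSub q p) (T : Fin q → Fin b → Fin c → ℤ) (hR : 0 < nRows q p c) (hC : 0 < nCols q p b)
    (ρ σ : ℕ) :
    kyCode q p b c dT dS T ρ σ =
      koszulFlatteningGen q p (1 : Matrix (Fin q) (Fin q) ℤ).mulVecLin T
        (rowDec q p c dT (ρ % nRows q p c)) (colDec q p b dS (σ % nCols q p b)) := by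
  unfold kyCode kyTable
  rw [mget_table _ (Nat.mod_lt _ hR) (Nat.mod_lt _ hC), kyEntry_eq]

/-- **`(q, p)` Koszul–Young certificate ⇒ `R ≤ bR`, every field.** If `kyCheck` certifies `n`
independent rows (unit pivots) of the integer flattening `T_{K^q}^{∧p}` and `C(q-1, p) · (R-1) < n`,
then `R ≤ bR(T ⊗ K)`. [cite: LandsbergOttaviani2015, Thm. 2.1] [cite: ConnerGesmundoLandsbergVentura2022, §3 eq. (8)] -/
theorem le_algBorderRank_of_kyCheck (K : Type u) [Field K] {q p b c : ℕ} [NeZero q] [NeZero b]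
    [NeZero c] {dT : PSub q (p + 1)} {dS : PSub q p} (T : Fin q → Fin b → Fin c → ℤ) {n R : ℕ}
    {rows : List (List (ℕ × ℤ))} {piv : List ℕ}
    (h : kyCheck q p b c dT dS T n rows piv = true) (hR : (q - 1).choose p * (R - 1) < n) :
    R ≤ algBorderRank (fun i j l => (T i j l : K)) := by
  unfold kyCheck at h
  simp only [Bool.and_eq_true, decide_eq_true_eq] at h
  obtain ⟨⟨hR0, hC0⟩, h⟩ := h
  have e : kyCode q p b c dT dS T = fun ρ σ =>
      koszulFlatteningGen q p (1 : Matrix (Fin q) (Fin q) ℤ).mulVecLin T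
        (rowDec q p c dT (ρ % nRows q p c)) (colDec q p b dS (σ % nCols q p b)) :=
    funext fun ρ => funext fun σ => kyCode_eq q p b c dT dS T hR0 hC0 ρ σ
  rw [e] at h
  have hr := le_rank_of_intTriCheckUnit (F := K)
    (koszulFlatteningGen q p (1 : Matrix (Fin q) (Fin q) ℤ).mulVecLin T)
    (fun ρ => rowDec q p c dT (ρ % nRows q p c)) (fun σ => colDec q p b dS (σ % nCols q p b)) h
  have hm : (koszulFlatteningGen q p (1 : Matrix (Fin q) (Fin q) ℤ).mulVecLin T).map
      (Int.cast : ℤ → K) =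
      koszulFlatteningGen q p ((1 : Matrix (Fin q) (Fin q) ℤ).map (Int.cast : ℤ → K)).mulVecLin
        (fun i j l => (T i j l : K)) :=
    koszulFlatteningGen_mulVecLin_map q p (Int.castRingHom K) 1 T
  rw [hm] at hr
  exact le_algBorderRank_of_lt_rank_koszulFlatteningGen q p _ _ (hR.trans_le hr)

/-! ## The two remaining coordinate permutations -/

/-- A bound certified for `(i, l, j) ↦ T i j l` (second and third factor exchanged) is a bound for
`T`. [cite: Blaser2013, §5.1 (permutation of tensors)] -/
theorem le_algBorderRank_of_swap₂₃' (K : Type u) [Field K] {a b c : ℕ}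
    (T : Fin a → Fin b → Fin c → ℤ) {R : ℕ} (h : R ≤ algBorderRank (fun i l j => (T i j l : K))) :
    R ≤ algBorderRank (fun i j l => (T i j l : K)) := by
  rw [← algBorderRank_swap₂₃ (fun i j l => (T i j l : K))]
  exact h

/-- A bound certified for `(j, i, l) ↦ T i j l` (first and second factor exchanged) is a bound for
`T`. [cite: Blaser2013, §5.1 (permutation of tensors)] -/
theorem le_algBorderRank_of_swap₁₂ (K : Type u) [Field K] {a b c : ℕ}
    (T : Fin a → Fin b → Fin c → ℤ) {R : ℕ} (h : R ≤ algBorderRank (fun j i l => (T i j l : K))) :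
    R ≤ algBorderRank (fun i j l => (T i j l : K)) := by
  refine le_algBorderRank_of_rotate₁ K T ?_
  rw [← algBorderRank_swap₂₃ (fun j l i => (T i j l : K))]
  exact h

end KYMask

end Literature.Computability.AlgebraicComplexity
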